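import Summits.AnomalousDissipation.AnomalousDissipation.Theorems.MirrorVarietyTaylorGreenLoudGalerkinStatesLine
import Summits.AnomalousDissipation.AnomalousDissipation.Theorems.MirrorVarietyTaylorGreenLoudGalerkinStatesStubTgForceRegular
import Literature.Analysis.FunctionSpaces.TorusReflectionCalculus
import Literature.Analysis.FunctionSpaces.TorusTrigPoly
import Literature.Analysis.FunctionSpaces.TorusInverseLaplacianCalculus
import Literature.Analysis.FunctionSpaces.TorusTestFunction
import Literature.Analysis.FunctionSpaces.TorusSobolevNormFacts

/-!
# Stub `stub_criticality` of the line `stagnation-plug-froth`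
# (crux stmt-AnomalousDissipation-2987, `MirrorVariety.TaylorGreenLoudGalerkinStates`)

**Palais' principle of symmetric criticality for the `K`-tested Galerkin equations.**  Let `K` be
the mirror group of the Taylor–Green force: the three commuting coordinate reflections
`R_i = reflMat i = diag(…, -1, …)` of `T³`, acting on points by `Torus.mulVecT (reflMat i)` and on
velocity values by `actVec (reflMat i)`; a field is `K`-symmetric (`IsKSymm`) iff it is fixed by the
three conjugations `ρ_i a = R_i ∘ a ∘ R_i` (`isKSymm_iff_refl_eq`).  For a smooth `K`-symmetric force
`f` and a smooth `K`-symmetric `U`, the tested steady form is `ρ_i`-INVARIANT in the test,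
`testedForm ν f U (ρ_i a) = testedForm ν f U a` (`testedForm_refl`: the integrand at `x` is the
integrand for `a` at `R_i x` — chain rule `Torus.fderiv_clm_comp_mulVecT`, the Laplacian of an
isometric pull-back `Torus.laplacian_comp_mulVecT`, `R_i` symmetric and involutive on `ℝ³` — and
`x ↦ R_i x` preserves Haar measure, `Torus.integral_comp_mulVecT_of_mul_eq_one`), and `ρ_i`
preserves smoothness, divergence-freeness (`Torus.IsDivFree.conj_mulVecT`) and band-limitation to
the punctured ball (`Torus.mFourierCoeff_complexify_conj_mulVecT`: `𝓕(ρ_i a)(k) = R_i 𝓕a(k R_i)`,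
and `|k R_i| = |k|`).  Hence (`stub_criticality`): if `U` solves the tested equations against all
band-limited smooth div-free `K`-symmetric tests, then against ANY band-limited smooth div-free
test `a` — symmetrise one reflection at a time, `a ↦ (a + ρ_i a)/2` (`i = 0, 1, 2`); the result is
`K`-symmetric, still admissible, and has the same tested value by linearity of
`testedForm ν f U ·` on smooth tests and invariance.  Mean-zero is never needed for tests.

Sources: R. Palais, Comm. Math. Phys. 69 (1979) 19–30 (the principle; here an elementary
finite-group instance); the vocabulary module `Theorems/MirrorVarietyTaylorGreenLoudGalerkinStatesLine.lean`;
the general torus lemmas are in `Literature/Analysis/FunctionSpaces/TorusReflectionCalculus.lean`;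
the coordinate formulas `mulVecT_reflMat_apply`, `actVec_reflMat_apply` are reused from the landed
stub file `…StubTgForceRegular.lean`.
-/

-- `Summit.<Summit>.<Problem>` is the tree's mandated summit-side namespace (CONVENTIONS §2); for this
-- single-conjunct summit the two coincide, so the duplicate is deliberate.
set_option linter.dupNamespace false

noncomputable section

open scoped BigOperators Topology InnerProductSpace
open Filter MeasureTheory
open Literature.Analysis.FunctionSpaces Literature.Analysis.FunctionSpaces.Torus

namespace Summit.AnomalousDissipation.AnomalousDissipation.Theorems.TaylorGreenLoudGalerkinStates.Criticality

open Summit.AnomalousDissipation.AnomalousDissipation.Theorems.TaylorGreenLoudGalerkinStates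
open Summit.AnomalousDissipation.AnomalousDissipation.Theorems.TaylorGreenLoudGalerkinStates.Negative
open Summit.AnomalousDissipation.AnomalousDissipation.Theorems.TaylorGreenLoudGalerkinStates.TgForceRegular

/-- `ρ[i] a = R_i ∘ a ∘ R_i = fun x => actVec (reflMat i) (a (Torus.mulVecT (reflMat i) x))`, the
conjugation of a vector field by the `i`-th coordinate reflection (a local macro, not a definition). -/
local notation "ρ[" i "] " a:max =>
  fun x => actVec (reflMat i) (a (Torus.mulVecT (reflMat i) x))

/-! ## The reflections: algebra on `ℤ³`, `ℝ³` and `T³` -/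

/-- `R_i² = 1` in `M₃(ℤ)`. [folklore] -/
theorem reflMat_mul_self (i : Fin 3) : reflMat i * reflMat i = 1 := by
  rw [reflMat, Matrix.diagonal_mul_diagonal, ← Matrix.diagonal_one]
  congr 1
  funext k
  split_ifs <;> simp

/-- `actVec M` is the real matrix `M_ℝ` of the tree (`Matrix.toEuclideanCLM`), definitionally. [folklore] -/
theorem actVec_eq_toEuclideanCLM (M : Matrix (Fin 3) (Fin 3) ℤ) (v : EuclideanSpace ℝ (Fin 3)) :
    actVec M v = Matrix.toEuclideanCLM (n := Fin 3) (𝕜 := ℝ) (M.map (Int.cast : ℤ → ℝ)) v :=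
  rfl

/-- `R_i (R_i v) = v` on `ℝ³`. [folklore] -/
theorem actVec_actVec (i : Fin 3) (v : EuclideanSpace ℝ (Fin 3)) :
    actVec (reflMat i) (actVec (reflMat i) v) = v := by
  refine euclid_ext3 ?_ ?_ ?_ <;> simp only [actVec_reflMat_apply] <;> split_ifs <;> simp

/-- `R_i (R_i x) = x` on `T³`. [folklore] -/
theorem mulVecT_mulVecT (i : Fin 3) (x : UnitAddTorus (Fin 3)) :
    Torus.mulVecT (reflMat i) (Torus.mulVecT (reflMat i) x) = x :=
  mulVecT_mulVecT_of_mul_eq_one (reflMat_mul_self i) x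

/-- The reflections commute on `ℝ³`. [folklore] -/
theorem actVec_comm (i j : Fin 3) (v : EuclideanSpace ℝ (Fin 3)) :
    actVec (reflMat i) (actVec (reflMat j) v) = actVec (reflMat j) (actVec (reflMat i) v) := by
  ext l
  simp only [actVec_reflMat_apply]
  split_ifs <;> ring

/-- The reflections commute on `T³`. [folklore] -/
theorem mulVecT_comm (i j : Fin 3) (x : UnitAddTorus (Fin 3)) :
    Torus.mulVecT (reflMat i) (Torus.mulVecT (reflMat j) x) =
      Torus.mulVecT (reflMat j) (Torus.mulVecT (reflMat i) x) := by
  funext l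
  simp only [mulVecT_reflMat_apply]
  split_ifs <;> simp

/-- `R_i` is an isometry of `ℝ³`. [folklore] -/
theorem norm_actVec (i : Fin 3) (v : EuclideanSpace ℝ (Fin 3)) : ‖actVec (reflMat i) v‖ = ‖v‖ := by
  simp only [EuclideanSpace.norm_eq, actVec_reflMat_apply]
  congr 1
  refine Finset.sum_congr rfl fun j _ => ?_
  split_ifs <;> simp

/-- `R_i` is symmetric on `ℝ³`: `⟪v, R_i w⟫ = ⟪R_i v, w⟫`. [folklore] -/
theorem inner_actVec_right (i : Fin 3) (v w : EuclideanSpace ℝ (Fin 3)) :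
    ⟪v, actVec (reflMat i) w⟫_ℝ = ⟪actVec (reflMat i) v, w⟫_ℝ := by
  simp only [PiLp.inner_apply, actVec_reflMat_apply, RCLike.inner_apply, conj_trivial]
  refine Finset.sum_congr rfl fun j _ => ?_
  split_ifs <;> ring

/-- The dual action on frequencies: `(k R_i)_l = ∓k_l`. [folklore] -/
theorem vecMul_reflMat_apply (k : Fin 3 → ℤ) (i l : Fin 3) :
    Matrix.vecMul k (reflMat i) l = if l = i then -k l else k l := by
  rw [reflMat, Matrix.vecMul_diagonal]
  split_ifs <;> simp

/-- `k ↦ k R_i` preserves the punctured frequency ball `0 < |k|² ≤ N²`. [folklore] -/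
theorem vecMul_reflMat_mem {N : ℕ} {k : Fin 3 → ℤ} (i : Fin 3)
    (hk : k ∈ (freqBall N).erase (0 : Fin 3 → ℤ)) :
    Matrix.vecMul k (reflMat i) ∈ (freqBall N).erase (0 : Fin 3 → ℤ) := by
  rw [Finset.mem_erase, mem_freqBall] at hk ⊢
  refine ⟨fun h0 => hk.1 ?_, ?_⟩
  · have h := congrArg (fun m => Matrix.vecMul m (reflMat i)) h0
    simpa only [Matrix.vecMul_vecMul, reflMat_mul_self, Matrix.vecMul_one, Matrix.zero_vecMul] using h
  · have hn : freqNormSq (Matrix.vecMul k (reflMat i)) = freqNormSq k := by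
      simp only [freqNormSq, vecMul_reflMat_apply]
      refine Finset.sum_congr rfl fun j _ => ?_
      split_ifs <;> push_cast <;> ring
    rw [hn]
    exact hk.2

/-- `K`-symmetry is being fixed by the three conjugations `ρ_i`. [folklore] -/
theorem isKSymm_iff_refl_eq (u : UnitAddTorus (Fin 3) → EuclideanSpace ℝ (Fin 3)) :
    IsKSymm u ↔ ∀ i, ρ[i] u = u := by
  constructor
  · intro h i
    funext x
    show actVec (reflMat i) (u (Torus.mulVecT (reflMat i) x)) = u x
    rw [h i x, actVec_actVec]
  · intro h i x
    have hx := congrFun (h i) (Torus.mulVecT (reflMat i) x)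
    beta_reduce at hx
    rw [mulVecT_mulVecT] at hx
    exact hx.symm

/-! ## The conjugations `ρ_i`: linear, commuting involutions preserving admissibility -/

section Conjugation

variable {N : ℕ} {a b : UnitAddTorus (Fin 3) → EuclideanSpace ℝ (Fin 3)}

/-- `ρ_i` is an involution. [folklore] -/
theorem refl_refl (i : Fin 3) (a : UnitAddTorus (Fin 3) → EuclideanSpace ℝ (Fin 3)) :
    ρ[i] (ρ[i] a) = a := by
  funext x
  show actVec (reflMat i) (actVec (reflMat i) (a (Torus.mulVecT (reflMat i) (Torus.mulVecT (reflMat i) x)))) = a x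
  rw [mulVecT_mulVecT, actVec_actVec]

/-- The `ρ_i` commute. [folklore] -/
theorem refl_comm (i j : Fin 3) (a : UnitAddTorus (Fin 3) → EuclideanSpace ℝ (Fin 3)) :
    ρ[i] (ρ[j] a) = ρ[j] (ρ[i] a) := by
  funext x
  show actVec (reflMat i) (actVec (reflMat j) (a (Torus.mulVecT (reflMat j) (Torus.mulVecT (reflMat i) x)))) =
    actVec (reflMat j) (actVec (reflMat i) (a (Torus.mulVecT (reflMat i) (Torus.mulVecT (reflMat j) x))))
  rw [mulVecT_comm j i x, actVec_comm]

/-- `ρ_i` is additive. [folklore] -/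
theorem refl_add (i : Fin 3) (a b : UnitAddTorus (Fin 3) → EuclideanSpace ℝ (Fin 3)) :
    ρ[i] (a + b) = ρ[i] a + ρ[i] b := by
  funext x
  simp only [Pi.add_apply, actVec_eq_toEuclideanCLM, map_add]

/-- `ρ_i` is `ℝ`-homogeneous. [folklore] -/
theorem refl_smul (i : Fin 3) (c : ℝ) (a : UnitAddTorus (Fin 3) → EuclideanSpace ℝ (Fin 3)) :
    ρ[i] (c • a) = c • ρ[i] a := by
  funext x
  simp only [Pi.smul_apply, actVec_eq_toEuclideanCLM, map_smul]

/-- `ρ_i` preserves smoothness. [folklore] -/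
theorem isSmooth_refl (i : Fin 3) (ha : IsSmooth a) : IsSmooth (ρ[i] a) :=
  (ha.comp_mulVecT' (reflMat i)).comp_clm
    (Matrix.toEuclideanCLM (n := Fin 3) (𝕜 := ℝ) ((reflMat i).map (Int.cast : ℤ → ℝ)))

/-- `ρ_i` preserves divergence-freeness (`div (R_i a R_i) = (div a) ∘ R_i`, trace of a conjugate).
[folklore] -/
theorem isDivFree_refl (i : Fin 3) (ha : IsSmooth a) (hd : IsDivFree a) : IsDivFree (ρ[i] a) :=
  hd.conj_mulVecT (ha.isContDiff (by simp)) (reflMat_mul_self i)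

/-- `ρ_i` preserves band-limitation to the punctured ball: `𝓕(ρ_i a)(k) = R_i 𝓕a(k R_i)` and
`k ↦ k R_i` preserves `0 < |k|² ≤ N²`. [folklore] -/
theorem isBandLimited_refl (i : Fin 3) (ha : IsSmooth a) (hb : IsBandLimited N a) :
    IsBandLimited N (ρ[i] a) := by
  intro k hk
  have key := mFourierCoeff_complexify_conj_mulVecT ha.continuous (reflMat_mul_self i) (reflMat i) k
  have hk' : Matrix.vecMul k (reflMat i) ∉ (freqBall N).erase (0 : Fin 3 → ℤ) := fun h => hk (by
    simpa only [Matrix.vecMul_vecMul, reflMat_mul_self, Matrix.vecMul_one] using vecMul_reflMat_mem i h)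
  rw [hb _ hk', map_zero] at key
  exact key

/-- Chain rule for `ρ_i`: `D(ρ_i a)(x) w = R_i (Da (R_i x) (R_i w))`. [folklore] -/
theorem fderiv_refl_apply (i : Fin 3) (ha : IsSmooth a) (x : UnitAddTorus (Fin 3))
    (w : EuclideanSpace ℝ (Fin 3)) :
    Torus.fderiv (ρ[i] a) x w =
      actVec (reflMat i) (Torus.fderiv a (Torus.mulVecT (reflMat i) x) (actVec (reflMat i) w)) :=
  congrArg (fun T : EuclideanSpace ℝ (Fin 3) →L[ℝ] EuclideanSpace ℝ (Fin 3) => T w)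
    (fderiv_clm_comp_mulVecT (ha.isContDiff (by simp))
      (Matrix.toEuclideanCLM (n := Fin 3) (𝕜 := ℝ) ((reflMat i).map (Int.cast : ℤ → ℝ))) (reflMat i) x)

/-- `Δ(ρ_i a)(x) = R_i (Δa (R_i x))` (`R_i` is an isometry of `ℝ³`). [folklore] -/
theorem laplacian_refl (i : Fin 3) (ha : IsSmooth a) (x : UnitAddTorus (Fin 3)) :
    laplacian (ρ[i] a) x = actVec (reflMat i) (laplacian a (Torus.mulVecT (reflMat i) x)) := by
  have e1 := laplacian_clm_comp_apply (ha.comp_mulVecT' (reflMat i))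
    (Matrix.toEuclideanCLM (n := Fin 3) (𝕜 := ℝ) ((reflMat i).map (Int.cast : ℤ → ℝ))) x
  rw [laplacian_comp_mulVecT (F := EuclideanSpace ℝ (Fin 3)) (M := reflMat i) (norm_actVec i) a x] at e1
  exact e1

end Conjugation

/-! ## The tested form: invariance under `ρ_i` and linearity in the test -/

section Tested

variable {ν : ℝ} {N : ℕ} {f U a b : UnitAddTorus (Fin 3) → EuclideanSpace ℝ (Fin 3)}

/-- **Invariance.** For `K`-symmetric `f`, `U` and a smooth test `a`:
`testedForm ν f U (ρ_i a) = testedForm ν f U a` — the integrand at `x` equals the integrand for `a`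
at `R_i x` (`R_i`-covariance of `(U·∇)`, `Δ` and `R_i = R_iᵀ = R_i⁻¹`), and `x ↦ R_i x` preserves
Haar measure (a measurable equivalence: no measurability of the integrand is needed, so no
regularity of `f`, `U` is assumed). [cite: Palais1979, §1] -/
theorem testedForm_refl (i : Fin 3) (hfk : IsKSymm f) (hUk : IsKSymm U) (ha : IsSmooth a) :
    testedForm ν f U (ρ[i] a) = testedForm ν f U a := by
  simp only [testedForm]
  rw [show (∫ x, ⟪U x, convect U a x⟫_ℝ + ν * ⟪U x, laplacian a x⟫_ℝ + ⟪f x, a x⟫_ℝ) =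
      ∫ x, (⟪U (Torus.mulVecT (reflMat i) x), convect U a (Torus.mulVecT (reflMat i) x)⟫_ℝ +
        ν * ⟪U (Torus.mulVecT (reflMat i) x), laplacian a (Torus.mulVecT (reflMat i) x)⟫_ℝ +
        ⟪f (Torus.mulVecT (reflMat i) x), a (Torus.mulVecT (reflMat i) x)⟫_ℝ) from
    (integral_comp_mulVecT_of_mul_eq_one (reflMat_mul_self i)
      (fun y => ⟪U y, convect U a y⟫_ℝ + ν * ⟪U y, laplacian a y⟫_ℝ + ⟪f y, a y⟫_ℝ)).symm]
  refine integral_congr_ae (ae_of_all _ fun x => ?_)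
  have h1 : convect U (ρ[i] a) x = actVec (reflMat i) (convect U a (Torus.mulVecT (reflMat i) x)) := by
    simp only [Torus.convect]
    rw [fderiv_refl_apply i ha, ← hUk i x]
  beta_reduce
  rw [h1, laplacian_refl i ha, inner_actVec_right, inner_actVec_right, inner_actVec_right, ← hUk i x, ← hfk i x]

/-- The integrand of `testedForm ν f U c` is integrable for smooth data (continuous on the compact
torus). [folklore] -/
theorem integrable_testedIntegrand (ν : ℝ) (hf : IsSmooth f) (hU : IsSmooth U) (ha : IsSmooth a) :
    Integrable (fun x => ⟪U x, convect U a x⟫_ℝ + ν * ⟪U x, laplacian a x⟫_ℝ + ⟪f x, a x⟫_ℝ) volume :=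
  (((hU.inner (hU.convect ha)).integrable).add
      ((hU.inner ha.laplacian).integrable.const_mul ν)).add (hf.inner ha).integrable

/-- `testedForm ν f U ·` is additive on smooth tests. [folklore] -/
theorem testedForm_add (hf : IsSmooth f) (hU : IsSmooth U) (ha : IsSmooth a) (hb : IsSmooth b) :
    testedForm ν f U (a + b) = testedForm ν f U a + testedForm ν f U b := by
  simp only [testedForm]
  rw [← integral_add (integrable_testedIntegrand ν hf hU ha) (integrable_testedIntegrand ν hf hU hb)]
  refine integral_congr_ae (ae_of_all _ fun x => ?_)
  have hc : convect U (a + b) x = convect U a x + convect U b x := by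
    simp only [Torus.convect]
    rw [Torus.fderiv_add (ha.isContDiff (by simp)) (hb.isContDiff (by simp))]
    rfl
  beta_reduce
  rw [hc, laplacian_add_apply ha hb x, Pi.add_apply, inner_add_right, inner_add_right, inner_add_right]
  ring

/-- `testedForm ν f U ·` is `ℝ`-homogeneous on smooth tests. [folklore] -/
theorem testedForm_smul (c : ℝ) (ha : IsSmooth a) :
    testedForm ν f U (c • a) = c * testedForm ν f U a := by
  simp only [testedForm]
  rw [← integral_const_mul]
  refine integral_congr_ae (ae_of_all _ fun x => ?_)
  have hc : convect U (c • a) x = c • convect U a x := by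
    simp only [Torus.convect]
    rw [Torus.fderiv_const_smul (ha.isContDiff (by simp))]
    rfl
  beta_reduce
  rw [hc, laplacian_const_smul_apply ha c x, Pi.smul_apply, inner_smul_right, inner_smul_right,
    inner_smul_right]
  ring

end Tested

/-! ## Symmetrisation one reflection at a time -/

section Average

variable {ν : ℝ} {N : ℕ} {f U b : UnitAddTorus (Fin 3) → EuclideanSpace ℝ (Fin 3)}

/-- The average `(b + ρ_i b)/2` is smooth. [folklore] -/
theorem isSmooth_avg (i : Fin 3) (hb : IsSmooth b) : IsSmooth ((1 / 2 : ℝ) • (b + ρ[i] b)) :=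
  (hb.add (isSmooth_refl i hb)).smul _

/-- The average `(b + ρ_i b)/2` is divergence free. [folklore] -/
theorem isDivFree_avg (i : Fin 3) (hb : IsSmooth b) (hbd : IsDivFree b) :
    IsDivFree ((1 / 2 : ℝ) • (b + ρ[i] b)) := by
  have h1 : IsContDiff 1 b := hb.isContDiff (by simp)
  have h2 : IsContDiff 1 (ρ[i] b) := (isSmooth_refl i hb).isContDiff (by simp)
  have hd2 : IsDivFree (ρ[i] b) := isDivFree_refl i hb hbd
  intro x
  rw [divergence_eq_trace_fderiv ((h1.add h2).smul _), Torus.fderiv_const_smul (h1.add h2),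
    Torus.fderiv_add h1 h2, ContinuousLinearMap.toLinearMap_smul, map_smul, ContinuousLinearMap.toLinearMap_add,
    map_add, ← divergence_eq_trace_fderiv h1, ← divergence_eq_trace_fderiv h2, hbd x, hd2 x, add_zero, smul_zero]

/-- The average `(b + ρ_i b)/2` is band-limited. [folklore] -/
theorem isBandLimited_avg (i : Fin 3) (hb : IsSmooth b) (hbb : IsBandLimited N b) :
    IsBandLimited N ((1 / 2 : ℝ) • (b + ρ[i] b)) := by
  intro k hk
  have hρ := isBandLimited_refl i hb hbb k hk
  have hint : ∀ c : UnitAddTorus (Fin 3) → EuclideanSpace ℝ (Fin 3), IsSmooth c →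
      Integrable (EuclideanSpace.complexify ∘ c) volume := fun c hc =>
    (EuclideanSpace.continuous_complexify.comp hc.continuous).integrable_unitAddTorus
  have hfun : EuclideanSpace.complexify ∘ ((1 / 2 : ℝ) • (b + ρ[i] b)) =
      ((1 / 2 : ℝ) : ℂ) • (EuclideanSpace.complexify ∘ b + EuclideanSpace.complexify ∘ ρ[i] b) := by
    funext x
    simp only [Function.comp_apply, Pi.smul_apply, Pi.add_apply, map_smul, map_add, Complex.coe_smul]
  rw [hfun, mFourierCoeff_const_smul, mFourierCoeff_add (hint _ hb) (hint _ (isSmooth_refl i hb)), hbb k hk,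
    hρ, add_zero, smul_zero]

/-- The average is fixed by `ρ_i` (`ρ_i` is a linear involution). [folklore] -/
theorem refl_avg_self (i : Fin 3) (b : UnitAddTorus (Fin 3) → EuclideanSpace ℝ (Fin 3)) :
    ρ[i] ((1 / 2 : ℝ) • (b + ρ[i] b)) = (1 / 2 : ℝ) • (b + ρ[i] b) := by
  rw [refl_smul, refl_add, refl_refl, add_comm]

/-- Averaging over `ρ_i` keeps `ρ_j`-fixed fields `ρ_j`-fixed (the `ρ`'s commute). [folklore] -/
theorem refl_avg_of_eq (i j : Fin 3) {b : UnitAddTorus (Fin 3) → EuclideanSpace ℝ (Fin 3)}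
    (hj : ρ[j] b = b) :
    ρ[j] ((1 / 2 : ℝ) • (b + ρ[i] b)) = (1 / 2 : ℝ) • (b + ρ[i] b) := by
  rw [refl_smul, refl_add, refl_comm j i, hj]

/-- Averaging does not change the tested value (linearity + invariance). [folklore] -/
theorem testedForm_avg (i : Fin 3) (hf : IsSmooth f) (hfk : IsKSymm f) (hU : IsSmooth U) (hUk : IsKSymm U)
    (hb : IsSmooth b) : testedForm ν f U ((1 / 2 : ℝ) • (b + ρ[i] b)) = testedForm ν f U b := by
  rw [testedForm_smul _ (hb.add (isSmooth_refl i hb)), testedForm_add hf hU hb (isSmooth_refl i hb),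
    testedForm_refl i hfk hUk hb]
  ring

end Average

/-! ## The registered stub -/

/-- **Stub `stub_criticality` (symmetric criticality, Palais 1979, for the mirror group `K` of the
Taylor–Green force).**  If a `K`-field `U`, band-limited to `0 < |k| ≤ N`, satisfies the tested
Galerkin equations `testedForm ν f U a = 0` for every band-limited smooth div-free `K`-SYMMETRIC
test `a` and the smooth force `f` is `K`-symmetric, then `testedForm ν f U a = 0` for EVERY
band-limited smooth div-free test `a`.  Proof: symmetrise `a` one reflection at a time,
`a₀ = (a + ρ₀a)/2`, `a₁ = (a₀ + ρ₁a₀)/2`, `a₂ = (a₁ + ρ₂a₁)/2`; `a₂` is `K`-symmetric and admissible,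
so `testedForm ν f U a₂ = 0`, and each averaging step preserves the tested value
(`testedForm_avg`). [cite: Palais1979, §1] -/
theorem stub_criticality : ∀ (ν : ℝ) (N : ℕ) (f U : UnitAddTorus (Fin 3) → EuclideanSpace ℝ (Fin 3)), IsSmooth f → IsKSymm f → IsKField U → IsBandLimited N U → (∀ a, IsSmooth a → IsDivFree a → IsKSymm a → IsBandLimited N a → testedForm ν f U a = 0) → ∀ a, IsSmooth a → IsDivFree a → IsBandLimited N a → testedForm ν f U a = 0 := by
  intro ν N f U hf hfk hU _hUb htest a ha had hab
  obtain ⟨hUs, -, -, hUk⟩ := hU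
  -- three successive averages
  have step : ∀ (i : Fin 3) (b : UnitAddTorus (Fin 3) → EuclideanSpace ℝ (Fin 3)),
      IsSmooth b → IsDivFree b → IsBandLimited N b →
      IsSmooth ((1 / 2 : ℝ) • (b + ρ[i] b)) ∧ IsDivFree ((1 / 2 : ℝ) • (b + ρ[i] b)) ∧
        IsBandLimited N ((1 / 2 : ℝ) • (b + ρ[i] b)) ∧
        testedForm ν f U ((1 / 2 : ℝ) • (b + ρ[i] b)) = testedForm ν f U b :=
    fun i b hb hbd hbb => ⟨isSmooth_avg i hb, isDivFree_avg i hb hbd, isBandLimited_avg i hb hbb,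
      testedForm_avg i hf hfk hUs hUk hb⟩
  obtain ⟨h0s, h0d, h0b, h0t⟩ := step 0 a ha had hab
  obtain ⟨h1s, h1d, h1b, h1t⟩ := step 1 _ h0s h0d h0b
  obtain ⟨h2s, h2d, h2b, h2t⟩ := step 2 _ h1s h1d h1b
  -- the third average is `K`-symmetric
  have hfix0 : ρ[0] ((1 / 2 : ℝ) • (a + ρ[0] a)) = (1 / 2 : ℝ) • (a + ρ[0] a) := refl_avg_self 0 a
  have hfix10 := refl_avg_of_eq 1 0 hfix0
  have hfix11 := refl_avg_self 1 ((1 / 2 : ℝ) • (a + ρ[0] a))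
  have hfix20 := refl_avg_of_eq 2 0 hfix10
  have hfix21 := refl_avg_of_eq 2 1 hfix11
  have hfix22 :=
    refl_avg_self 2 ((1 / 2 : ℝ) • ((1 / 2 : ℝ) • (a + ρ[0] a) + ρ[1] ((1 / 2 : ℝ) • (a + ρ[0] a))))
  have hK : IsKSymm ((1 / 2 : ℝ) •
      ((1 / 2 : ℝ) • ((1 / 2 : ℝ) • (a + ρ[0] a) + ρ[1] ((1 / 2 : ℝ) • (a + ρ[0] a))) +
        ρ[2] ((1 / 2 : ℝ) • ((1 / 2 : ℝ) • (a + ρ[0] a) + ρ[1] ((1 / 2 : ℝ) • (a + ρ[0] a)))))) := by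
    rw [isKSymm_iff_refl_eq]
    intro i
    fin_cases i
    · exact hfix20
    · exact hfix21
    · exact hfix22
  have h := htest _ h2s h2d hK h2b
  rw [h2t, h1t, h0t] at h
  exact h

end Summit.AnomalousDissipation.AnomalousDissipation.Theorems.TaylorGreenLoudGalerkinStates.Criticality

end
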